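import Literature.Analysis.FluidPDE.SawtoothCascadeProfileHigherDerivatives
import HarnessLib

/-!
# K1loc, line `Spectral` / SeqCone — helper: CURVATURE OF THE ROUNDED SAWTOOTH IS CONTROLLED BY THE SLOPE DEFICIT
# (distance-free flat-curvature lemma; S-B multiplier data without `1/ε` losses)

Helper file of the prover lane on the crux `K1LocalisedCascade` (stmt-AnomalousDissipation-19491), route
`SawtoothPulseCascade` (glue seat k1loc-p3; sequel of `…FlatSlope`).  The strip cut-offs `X = sT((σU_j′ − c₀)/ε)` and the
residual shear `U_j − Ũ_j` are differentiated where the slope `U_j′` is within `O(ε)` of `±1`; the crude caps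
`|U_j″| ≤ 2√(2π)N_j/δ_j`, `|U_j‴| ≤ 2(2πN_j)²/δ_j²` then cost a factor `ε⁻ᵏ`.  Here we prove that the higher derivatives are
themselves `O(ε)` there, up to the logarithmic factor `M ≈ √(2 ln(1/ε))`.  With `S_δ = tri ⋆ g_δ`, `s₀ = ±1` and the weight
`w = 1 − s₀ tri′ ∈ [0,2]`:  `1 − s₀S_δ′(x) = ∫ w(s) g_δ(x−s) ds`, and since `∫ g_δ′ = ∫ g_δ″ = 0`,
`S_δ″(x) = −s₀ ∫ w(s) g_δ′(x−s) ds`, `S_δ‴(x) = −s₀ ∫ w(s) g_δ″(x−s) ds`.  The exponential bathtub bounds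
`|u| ≤ t + λ⁻¹e^{λ(|u|−t)}`, `u² ≤ 2t² + 8λ⁻²e^{λ(|u|−t)}` with `t = Mδ`, `λ = M/δ` and the Gaussian exponential moment
`∫ e^{λu} g_δ(u) du = e^{λ²δ²/2}` give, for every `x`, every `M > 0` and `s₀ = ±1`:
* `abs_deriv2_roundedSaw_le_of_slope` — `|S_δ″(x)| ≤ (M/δ)(1 − s₀S_δ′(x)) + (4/(Mδ)) e^{−M²/2}`;
* `abs_deriv3_roundedSaw_le_of_slope` — `|S_δ‴(x)| ≤ ((1 + 2M²)/δ²)(1 − s₀S_δ′(x)) + (32/(M²δ²)) e^{−M²/2}`.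
(The cascade versions `U_j = S_{δ_j}(2πN_j·)/(2πN_j)` and the `ε`-layer corollaries are in `…FlatCurvatureCascade`.)
No definitions; no statement about the stub.  [cite: Folland1999, §8.2 Prop. 8.10 and Prop. 2.53] [problem: turb]
-/

-- `Summit.<Summit>.<Problem>`: single-conjunct summit, the duplicate namespace segment is deliberate.
set_option linter.dupNamespace false

noncomputable section

namespace Summit.AnomalousDissipation.AnomalousDissipation.Theorems.SawtoothPulseCascade.K1Flat

open MeasureTheory Set Filter Topology Real
open Literature.Analysis.FluidPDE.SawtoothCascade

/-! ## §1 Exponential moments of the Gaussian kernel -/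

/-- Completing the square: `e^{λu} g_δ(u) = e^{λ²δ²/2} g_δ(u − λδ²)` (`δ ≠ 0`). [cite: Folland1999, Prop. 2.53 (Gaussian integrals)] -/
theorem exp_mul_mul_gaussKernel_eq {δ : ℝ} (hδ : δ ≠ 0) (lam u : ℝ) :
    Real.exp (lam * u) * gaussKernel δ u = Real.exp (lam ^ 2 * δ ^ 2 / 2) * gaussKernel δ (u - lam * δ ^ 2) := by
  unfold gaussKernel
  rw [← mul_div_assoc, ← Real.exp_add, ← mul_div_assoc, ← Real.exp_add]
  congr 2
  field_simp
  ring

/-- **Exponential moment of the Gaussian kernel**: `∫ e^{λu} g_δ(u) du = e^{λ²δ²/2}` (`δ > 0`).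
[cite: Folland1999, Prop. 2.53 (Gaussian integrals)] -/
theorem integral_exp_mul_gaussKernel {δ : ℝ} (hδ : 0 < δ) (lam : ℝ) :
    ∫ u, Real.exp (lam * u) * gaussKernel δ u = Real.exp (lam ^ 2 * δ ^ 2 / 2) := by
  simp_rw [exp_mul_mul_gaussKernel_eq hδ.ne' lam]
  rw [integral_const_mul, integral_sub_right_eq_self (gaussKernel δ) (lam * δ ^ 2), integral_gaussKernel hδ, mul_one]

/-- `u ↦ e^{λu} g_δ(u)` is integrable (`δ > 0`). [cite: Folland1999, Prop. 2.53 (Gaussian integrals)] -/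
theorem integrable_exp_mul_gaussKernel {δ : ℝ} (hδ : 0 < δ) (lam : ℝ) :
    Integrable (fun u => Real.exp (lam * u) * gaussKernel δ u) := by
  refine integrable_exp_mul_mul_of_gaussian_bound (continuous_gaussKernel δ) (K := 1 / (δ * Real.sqrt (2 * Real.pi)))
    (b := 1 / (2 * δ ^ 2)) (by positivity) (fun z => ?_) lam
  rw [abs_of_nonneg (gaussKernel_nonneg hδ.le z)]
  unfold gaussKernel
  rw [div_eq_mul_one_div, mul_comm]
  refine le_of_eq ?_
  congr 2
  ring

/-- `u ↦ e^{λ|u|} g_δ(u)` is integrable, with `∫ e^{λ|u|} g_δ(u) du ≤ 2e^{λ²δ²/2}` (`δ > 0`). [cite: Folland1999, Prop. 2.53 (Gaussian integrals)] -/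
theorem integral_exp_mul_abs_gaussKernel_le {δ : ℝ} (hδ : 0 < δ) (lam : ℝ) :
    Integrable (fun u => Real.exp (lam * |u|) * gaussKernel δ u) ∧
    ∫ u, Real.exp (lam * |u|) * gaussKernel δ u ≤ 2 * Real.exp (lam ^ 2 * δ ^ 2 / 2) := by
  have h1 := integrable_exp_mul_gaussKernel hδ lam
  have h2 := integrable_exp_mul_gaussKernel hδ (-lam)
  have hle : ∀ u, Real.exp (lam * |u|) * gaussKernel δ u ≤
      Real.exp (lam * u) * gaussKernel δ u + Real.exp (-lam * u) * gaussKernel δ u := by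
    intro u
    have hg := gaussKernel_nonneg hδ.le u
    rw [← add_mul]
    refine mul_le_mul_of_nonneg_right ?_ hg
    rcases le_or_gt 0 u with hu | hu
    · rw [abs_of_nonneg hu]; linarith [Real.exp_pos (-lam * u)]
    · rw [abs_of_neg hu, show lam * -u = -lam * u by ring]; linarith [Real.exp_pos (lam * u)]
  have hint : Integrable (fun u => Real.exp (lam * |u|) * gaussKernel δ u) := by
    refine (h1.add h2).mono' (((Real.continuous_exp.comp (continuous_const.mul continuous_abs)).mul
      (continuous_gaussKernel δ)).aestronglyMeasurable) (ae_of_all _ fun u => ?_)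
    rw [Real.norm_eq_abs, abs_of_nonneg (mul_nonneg (Real.exp_pos _).le (gaussKernel_nonneg hδ.le u))]
    exact hle u
  refine ⟨hint, ?_⟩
  calc ∫ u, Real.exp (lam * |u|) * gaussKernel δ u
      ≤ ∫ u, (Real.exp (lam * u) * gaussKernel δ u + Real.exp (-lam * u) * gaussKernel δ u) :=
        integral_mono hint (h1.add h2) hle
    _ = 2 * Real.exp (lam ^ 2 * δ ^ 2 / 2) := by
        rw [integral_add h1 h2, integral_exp_mul_gaussKernel hδ, integral_exp_mul_gaussKernel hδ, neg_sq]; ring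

/-! ## §2 Exponential bathtub bounds -/

/-- `|u| ≤ t + λ⁻¹ e^{λ(|u| − t)}` for `λ > 0` (from `1 + y ≤ eʸ`). [folklore] -/
theorem abs_le_add_exp (u t : ℝ) {lam : ℝ} (hlam : 0 < lam) : |u| ≤ t + lam⁻¹ * Real.exp (lam * (|u| - t)) := by
  have h := Real.add_one_le_exp (lam * (|u| - t))
  have h2 : lam * (|u| - t) ≤ Real.exp (lam * (|u| - t)) := by linarith
  rw [← sub_le_iff_le_add', ← mul_le_mul_iff_of_pos_left hlam]
  calc lam * (|u| - t) ≤ Real.exp (lam * (|u| - t)) := h2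
    _ = lam * (lam⁻¹ * Real.exp (lam * (|u| - t))) := by field_simp

/-- `u² ≤ 2t² + 8λ⁻² e^{λ(|u| − t)}` for `λ > 0` (from `y² ≤ 4eʸ` for `y ≥ 0`). [folklore] -/
theorem sq_le_add_exp (u t : ℝ) {lam : ℝ} (hlam : 0 < lam) :
    u ^ 2 ≤ 2 * t ^ 2 + 8 * lam⁻¹ ^ 2 * Real.exp (lam * (|u| - t)) := by
  have hexp := Real.exp_pos (lam * (|u| - t))
  rcases le_or_gt |u| t with hu | hu
  · have : u ^ 2 ≤ t ^ 2 := by rw [← sq_abs]; exact pow_le_pow_left₀ (abs_nonneg u) hu 2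
    nlinarith [sq_nonneg lam⁻¹]
  · -- `y = λ(|u| − t) > 0`, `y² ≤ 4 eʸ`
    set y := lam * (|u| - t) with hy
    have hy0 : 0 ≤ y := by rw [hy]; exact mul_nonneg hlam.le (by linarith)
    have hhalf := Real.add_one_le_exp (y / 2)
    have hy2 : y ^ 2 ≤ 4 * Real.exp y := by
      have e2 : Real.exp y = Real.exp (y / 2) ^ 2 := by rw [sq, ← Real.exp_add]; ring_nf
      rw [e2]; nlinarith [Real.exp_pos (y / 2)]
    have hut : (|u| - t) = lam⁻¹ * y := by rw [hy]; field_simp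
    have hsq : u ^ 2 ≤ 2 * t ^ 2 + 2 * (|u| - t) ^ 2 := by
      rw [← sq_abs u]; nlinarith [sq_nonneg (|u| - 2 * t)]
    rw [hut, mul_pow] at hsq
    nlinarith [sq_nonneg lam⁻¹, mul_le_mul_of_nonneg_left hy2 (sq_nonneg lam⁻¹)]


/-! ## §3 The slope deficit and the higher derivatives as weighted Gaussian integrals -/

/-- `∫ g_δ′ = 0`: the first-derivative kernel `−(u/δ²)g_δ(u)` is odd. [cite: Folland1999, Prop. 2.53 (Gaussian integrals)] -/
theorem integral_gaussKernel_deriv1 (δ : ℝ) : ∫ u, -(u / δ ^ 2) * gaussKernel δ u = 0 := by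
  -- the kernel is even (tree: `…Theorems.Cascade.gaussKernel_neg`; one-line here to keep the imports light)
  have hev : ∀ u, gaussKernel δ (-u) = gaussKernel δ u := fun u => by unfold gaussKernel; rw [neg_sq]
  have h := integral_neg_eq_self (fun u => -(u / δ ^ 2) * gaussKernel δ u) volume
  simp only [hev, neg_div, neg_neg] at h
  have h2 : ∫ u, u / δ ^ 2 * gaussKernel δ u = -∫ u, -(u / δ ^ 2) * gaussKernel δ u := by
    rw [← integral_neg]; refine integral_congr_ae (Eventually.of_forall fun u => ?_); simp only; ring
  linarith

/-- `∫ g_δ″ = 0` (`δ > 0`): `∫ (u²/δ⁴ − 1/δ²) g_δ = δ²/δ⁴ − 1/δ² = 0`. [cite: Folland1999, Prop. 2.53 (Gaussian integrals)] -/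
theorem integral_gaussKernel_deriv2 {δ : ℝ} (hδ : 0 < δ) : ∫ u, (u ^ 2 / δ ^ 4 - 1 / δ ^ 2) * gaussKernel δ u = 0 := by
  have e : (fun u => (u ^ 2 / δ ^ 4 - 1 / δ ^ 2) * gaussKernel δ u) =
      fun u => (1 / δ ^ 4) * (u ^ 2 * gaussKernel δ u) - (1 / δ ^ 2) * gaussKernel δ u := by
    funext u; ring
  rw [e, integral_sub ((integrable_pow_mul_gaussKernel hδ 2).const_mul _) ((integrable_gaussKernel hδ).const_mul _),
    integral_const_mul, integral_const_mul, integral_sq_mul_gaussKernel hδ, integral_gaussKernel hδ]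
  field_simp
  ring

/-- The weight `w = 1 − s₀·tri′` (`s₀ = ±1`) takes values in `[0, 2]` and `|tri′ − s₀| = w`. [folklore] -/
theorem weight_bounds {s₀ : ℝ} (hs₀ : s₀ = 1 ∨ s₀ = -1) (s : ℝ) :
    0 ≤ 1 - s₀ * deriv tri s ∧ 1 - s₀ * deriv tri s ≤ 2 ∧ |deriv tri s - s₀| = 1 - s₀ * deriv tri s := by
  have h := abs_le.mp (abs_deriv_tri_le_one s)
  rcases hs₀ with rfl | rfl
  · refine ⟨by linarith, by linarith, ?_⟩
    rw [abs_of_nonpos (by linarith)]; ring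
  · refine ⟨by linarith, by linarith, ?_⟩
    rw [abs_of_nonneg (by linarith)]; ring

/-- The weight is measurable. [folklore] -/
theorem measurable_weight (s₀ : ℝ) : Measurable fun s => 1 - s₀ * deriv tri s :=
  measurable_const.sub (measurable_const.mul (measurable_deriv tri))

/-- A bounded measurable weight times a translated integrable kernel is integrable. [folklore] -/
theorem integrable_weight_mul {s₀ : ℝ} (hs₀ : s₀ = 1 ∨ s₀ = -1) {K : ℝ → ℝ} (hK : Integrable K) (x : ℝ) :
    Integrable fun s => (1 - s₀ * deriv tri s) * K (x - s) := by
  refine (hK.comp_sub_left x).bdd_mul (measurable_weight s₀).aestronglyMeasurable (c := 2) (ae_of_all _ fun s => ?_)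
  obtain ⟨h0, h2, -⟩ := weight_bounds hs₀ s
  rw [Real.norm_eq_abs, abs_of_nonneg h0]; exact h2

/-- **The slope deficit as a weighted Gaussian mass**: `1 − s₀S_δ′(x) = ∫ (1 − s₀tri′(s)) g_δ(x − s) ds` (`δ > 0`, `s₀ = ±1`).
[cite: Folland1999, §8.2 Prop. 8.10 (∂(f ∗ g) = (∂f) ∗ g)] -/
theorem one_sub_mul_deriv_roundedSaw_eq {δ : ℝ} (hδ : 0 < δ) (s₀ x : ℝ) :
    1 - s₀ * deriv (roundedSaw δ) x = ∫ s, (1 - s₀ * deriv tri s) * gaussKernel δ (x - s) := by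
  have hg := integrable_gaussKernel hδ
  have h1 : ∫ s, gaussKernel δ (x - s) = 1 := by rw [integral_sub_left_eq_self (gaussKernel δ) volume x, integral_gaussKernel hδ]
  have hI : Integrable fun s => deriv tri s * gaussKernel δ (x - s) :=
    (hg.comp_sub_left x).bdd_mul (measurable_deriv tri).aestronglyMeasurable (c := 1)
      (ae_of_all _ fun s => by rw [Real.norm_eq_abs]; exact abs_deriv_tri_le_one s)
  have e : (fun s => (1 - s₀ * deriv tri s) * gaussKernel δ (x - s)) =
      fun s => gaussKernel δ (x - s) - s₀ * (deriv tri s * gaussKernel δ (x - s)) := by funext s; ring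
  rw [e, integral_sub (hg.comp_sub_left x) (hI.const_mul s₀), integral_const_mul, h1, deriv_roundedSaw_eq hδ x]

/-- **`S_δ″` as a weighted integral**: `∫ (1 − s₀tri′(s)) g_δ′(x − s) ds = −s₀ S_δ″(x)`, `g_δ′(u) = −(u/δ²)g_δ(u)`
(`δ > 0`; uses `∫ g_δ′ = 0`). [cite: Folland1999, §8.2 Prop. 8.10 (∂(f ∗ g) = f ∗ ∂g)] -/
theorem integral_weight_mul_gaussKernel_deriv1 {δ : ℝ} (hδ : 0 < δ) (s₀ x : ℝ) :
    ∫ s, (1 - s₀ * deriv tri s) * (-((x - s) / δ ^ 2) * gaussKernel δ (x - s)) =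
      -(s₀ * deriv (deriv (roundedSaw δ)) x) := by
  have hK := integrable_gaussKernel_deriv1 hδ
  have hK0 : ∫ s, -((x - s) / δ ^ 2) * gaussKernel δ (x - s) = 0 := by
    rw [integral_sub_left_eq_self (fun u => -(u / δ ^ 2) * gaussKernel δ u) volume x]; exact integral_gaussKernel_deriv1 δ
  have hI : Integrable fun s => deriv tri s * (-((x - s) / δ ^ 2) * gaussKernel δ (x - s)) :=
    (hK.comp_sub_left x).bdd_mul (measurable_deriv tri).aestronglyMeasurable (c := 1)
      (ae_of_all _ fun s => by rw [Real.norm_eq_abs]; exact abs_deriv_tri_le_one s)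
  have hS : deriv (deriv (roundedSaw δ)) x = ∫ s, deriv tri s * (-((x - s) / δ ^ 2) * gaussKernel δ (x - s)) := by
    have := congrFun (deriv2_roundedSaw_eq hδ) x; simpa using this
  have e : (fun s => (1 - s₀ * deriv tri s) * (-((x - s) / δ ^ 2) * gaussKernel δ (x - s))) =
      fun s => (-((x - s) / δ ^ 2) * gaussKernel δ (x - s)) - s₀ * (deriv tri s * (-((x - s) / δ ^ 2) * gaussKernel δ (x - s))) := by
    funext s; ring
  rw [e, integral_sub (hK.comp_sub_left x) (hI.const_mul s₀), integral_const_mul, hK0, ← hS, zero_sub]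

/-- **`S_δ‴` as a weighted integral**: `∫ (1 − s₀tri′(s)) g_δ″(x − s) ds = −s₀ S_δ‴(x)`, `g_δ″(u) = (u²/δ⁴ − 1/δ²)g_δ(u)`
(`δ > 0`; uses `∫ g_δ″ = 0`). [cite: Folland1999, §8.2 Prop. 8.10 (∂(f ∗ g) = f ∗ ∂g)] -/
theorem integral_weight_mul_gaussKernel_deriv2 {δ : ℝ} (hδ : 0 < δ) (s₀ x : ℝ) :
    ∫ s, (1 - s₀ * deriv tri s) * (((x - s) ^ 2 / δ ^ 4 - 1 / δ ^ 2) * gaussKernel δ (x - s)) =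
      -(s₀ * deriv (deriv (deriv (roundedSaw δ))) x) := by
  have hK := integrable_gaussKernel_deriv2 hδ
  have hK0 : ∫ s, ((x - s) ^ 2 / δ ^ 4 - 1 / δ ^ 2) * gaussKernel δ (x - s) = 0 := by
    rw [integral_sub_left_eq_self (fun u => (u ^ 2 / δ ^ 4 - 1 / δ ^ 2) * gaussKernel δ u) volume x]
    exact integral_gaussKernel_deriv2 hδ
  have hI : Integrable fun s => deriv tri s * (((x - s) ^ 2 / δ ^ 4 - 1 / δ ^ 2) * gaussKernel δ (x - s)) :=
    (hK.comp_sub_left x).bdd_mul (measurable_deriv tri).aestronglyMeasurable (c := 1)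
      (ae_of_all _ fun s => by rw [Real.norm_eq_abs]; exact abs_deriv_tri_le_one s)
  have hS : deriv (deriv (deriv (roundedSaw δ))) x =
      ∫ s, deriv tri s * (((x - s) ^ 2 / δ ^ 4 - 1 / δ ^ 2) * gaussKernel δ (x - s)) := by
    have := congrFun (deriv3_roundedSaw_eq hδ) x; simpa using this
  have e : (fun s => (1 - s₀ * deriv tri s) * (((x - s) ^ 2 / δ ^ 4 - 1 / δ ^ 2) * gaussKernel δ (x - s))) =
      fun s => (((x - s) ^ 2 / δ ^ 4 - 1 / δ ^ 2) * gaussKernel δ (x - s)) -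
        s₀ * (deriv tri s * (((x - s) ^ 2 / δ ^ 4 - 1 / δ ^ 2) * gaussKernel δ (x - s))) := by
    funext s; ring
  rw [e, integral_sub (hK.comp_sub_left x) (hI.const_mul s₀), integral_const_mul, hK0, ← hS, zero_sub]

/-! ## §4 The flat-curvature bounds -/

/-- **Flat-curvature lemma (second derivative).**  For `δ > 0`, `M > 0`, `s₀ = ±1` and every `x`:
`|S_δ″(x)| ≤ (M/δ)(1 − s₀S_δ′(x)) + (4/(Mδ)) e^{−M²/2}` — the curvature is controlled by the slope deficit, with an
exponentially small remainder; no localisation to a branch is needed. [cite: Folland1999, §8.2 Prop. 8.10 and Prop. 2.53] -/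
theorem abs_deriv2_roundedSaw_le_of_slope {δ M : ℝ} (hδ : 0 < δ) (hM : 0 < M) {s₀ : ℝ} (hs₀ : s₀ = 1 ∨ s₀ = -1) (x : ℝ) :
    |deriv (deriv (roundedSaw δ)) x| ≤
      M / δ * (1 - s₀ * deriv (roundedSaw δ) x) + 4 / (M * δ) * Real.exp (-(M ^ 2 / 2)) := by
  have hs1 : |s₀| = 1 := by rcases hs₀ with rfl | rfl <;> norm_num
  set lam : ℝ := M / δ with hlam
  have hlam0 : 0 < lam := by positivity
  -- integrability
  have hIw := integrable_weight_mul hs₀ (integrable_gaussKernel hδ) x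
  have hIK := integrable_weight_mul hs₀ (integrable_gaussKernel_deriv1 hδ) x
  obtain ⟨hIe0, hIe_le⟩ := integral_exp_mul_abs_gaussKernel_le hδ lam
  have hIe : Integrable fun s => Real.exp (lam * |x - s|) * gaussKernel δ (x - s) := hIe0.comp_sub_left x
  -- step A: `|S″| ≤ ∫ w |x−s|/δ² g`
  have hA : |deriv (deriv (roundedSaw δ)) x| ≤
      ∫ s, (1 - s₀ * deriv tri s) * (|x - s| / δ ^ 2 * gaussKernel δ (x - s)) := by
    rw [show |deriv (deriv (roundedSaw δ)) x| = |∫ s, (1 - s₀ * deriv tri s) * (-((x - s) / δ ^ 2) * gaussKernel δ (x - s))| by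
      rw [integral_weight_mul_gaussKernel_deriv1 hδ s₀ x, abs_neg, abs_mul, hs1, one_mul]]
    refine (abs_integral_le_integral_abs).trans (le_of_eq (integral_congr_ae (Eventually.of_forall fun s => ?_)))
    obtain ⟨h0, -, -⟩ := weight_bounds hs₀ s
    simp only
    rw [abs_mul, abs_of_nonneg h0, abs_mul, abs_neg, abs_div, abs_of_pos (pow_pos hδ 2),
      abs_of_nonneg (gaussKernel_nonneg hδ.le _)]
  -- step B: pointwise bathtub bound
  have hpt : ∀ s, (1 - s₀ * deriv tri s) * (|x - s| / δ ^ 2 * gaussKernel δ (x - s)) ≤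
      (M * δ / δ ^ 2) * ((1 - s₀ * deriv tri s) * gaussKernel δ (x - s)) +
        (2 * lam⁻¹ * Real.exp (-(lam * (M * δ))) / δ ^ 2) * (Real.exp (lam * |x - s|) * gaussKernel δ (x - s)) := by
    intro s
    obtain ⟨h0, h2, -⟩ := weight_bounds hs₀ s
    have hg := gaussKernel_nonneg hδ.le (x - s)
    have hb := abs_le_add_exp (x - s) (M * δ) hlam0
    have hexp : Real.exp (lam * (|x - s| - M * δ)) = Real.exp (-(lam * (M * δ))) * Real.exp (lam * |x - s|) := by
      rw [← Real.exp_add]; ring_nf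
    rw [hexp] at hb
    have hwg : 0 ≤ (1 - s₀ * deriv tri s) * gaussKernel δ (x - s) := mul_nonneg h0 hg
    have hE : 0 ≤ Real.exp (-(lam * (M * δ))) * Real.exp (lam * |x - s|) := by positivity
    -- `w·|u|·g ≤ w (t + …) g ≤ t w g + 2 (…) g`
    calc (1 - s₀ * deriv tri s) * (|x - s| / δ ^ 2 * gaussKernel δ (x - s))
        = (1 / δ ^ 2) * (|x - s| * ((1 - s₀ * deriv tri s) * gaussKernel δ (x - s))) := by ring
      _ ≤ (1 / δ ^ 2) * ((M * δ + lam⁻¹ * (Real.exp (-(lam * (M * δ))) * Real.exp (lam * |x - s|))) *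
            ((1 - s₀ * deriv tri s) * gaussKernel δ (x - s))) :=
          mul_le_mul_of_nonneg_left (mul_le_mul_of_nonneg_right hb hwg) (by positivity)
      _ ≤ (1 / δ ^ 2) * ((M * δ) * ((1 - s₀ * deriv tri s) * gaussKernel δ (x - s)) +
            lam⁻¹ * (Real.exp (-(lam * (M * δ))) * Real.exp (lam * |x - s|)) * (2 * gaussKernel δ (x - s))) := by
          refine mul_le_mul_of_nonneg_left ?_ (by positivity)
          rw [add_mul]
          refine add_le_add le_rfl (mul_le_mul_of_nonneg_left ?_ (by positivity))
          exact mul_le_mul_of_nonneg_right h2 hg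
      _ = _ := by ring
  have hB : ∫ s, (1 - s₀ * deriv tri s) * (|x - s| / δ ^ 2 * gaussKernel δ (x - s)) ≤
      (M * δ / δ ^ 2) * (∫ s, (1 - s₀ * deriv tri s) * gaussKernel δ (x - s)) +
        (2 * lam⁻¹ * Real.exp (-(lam * (M * δ))) / δ ^ 2) * (∫ s, Real.exp (lam * |x - s|) * gaussKernel δ (x - s)) := by
    have hIabs : Integrable fun s => (1 - s₀ * deriv tri s) * (|x - s| / δ ^ 2 * gaussKernel δ (x - s)) := by
      have h := integrable_weight_mul hs₀ ((integrable_abs_mul_gaussKernel hδ).div_const (δ ^ 2)) x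
      refine h.congr (ae_of_all _ fun s => ?_); simp only; ring
    rw [← integral_const_mul, ← integral_const_mul, ← integral_add ((hIw.const_mul _)) (hIe.const_mul _)]
    exact integral_mono hIabs ((hIw.const_mul _).add (hIe.const_mul _)) hpt
  -- evaluate
  rw [← one_sub_mul_deriv_roundedSaw_eq hδ s₀ x, integral_sub_left_eq_self (fun u => Real.exp (lam * |u|) * gaussKernel δ u) volume x]
    at hB
  have hq0 : 0 ≤ 1 - s₀ * deriv (roundedSaw δ) x := by
    rw [one_sub_mul_deriv_roundedSaw_eq hδ s₀ x]
    exact integral_nonneg fun s => mul_nonneg (weight_bounds hs₀ s).1 (gaussKernel_nonneg hδ.le _)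
  have hexp2 : Real.exp (-(lam * (M * δ))) * (2 * Real.exp (lam ^ 2 * δ ^ 2 / 2)) = 2 * Real.exp (-(M ^ 2 / 2)) := by
    rw [mul_comm, mul_assoc, ← Real.exp_add, hlam]; congr 2; field_simp; ring
  calc |deriv (deriv (roundedSaw δ)) x| ≤ _ := hA
    _ ≤ _ := hB
    _ ≤ (M * δ / δ ^ 2) * (1 - s₀ * deriv (roundedSaw δ) x) +
          (2 * lam⁻¹ * Real.exp (-(lam * (M * δ))) / δ ^ 2) * (2 * Real.exp (lam ^ 2 * δ ^ 2 / 2)) :=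
        add_le_add le_rfl (mul_le_mul_of_nonneg_left hIe_le (by positivity))
    _ = M / δ * (1 - s₀ * deriv (roundedSaw δ) x) + 4 / (M * δ) * Real.exp (-(M ^ 2 / 2)) := by
        rw [show 2 * lam⁻¹ * Real.exp (-(lam * (M * δ))) / δ ^ 2 * (2 * Real.exp (lam ^ 2 * δ ^ 2 / 2)) =
          2 * lam⁻¹ / δ ^ 2 * (Real.exp (-(lam * (M * δ))) * (2 * Real.exp (lam ^ 2 * δ ^ 2 / 2))) by ring, hexp2, hlam]
        field_simp
        ring


/-- **Flat-curvature lemma (third derivative).**  For `δ > 0`, `M > 0`, `s₀ = ±1` and every `x`: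
`|S_δ‴(x)| ≤ ((1 + 2M²)/δ²)(1 − s₀S_δ′(x)) + (32/(M²δ²)) e^{−M²/2}`. [cite: Folland1999, §8.2 Prop. 8.10 and Prop. 2.53] -/
theorem abs_deriv3_roundedSaw_le_of_slope {δ M : ℝ} (hδ : 0 < δ) (hM : 0 < M) {s₀ : ℝ} (hs₀ : s₀ = 1 ∨ s₀ = -1) (x : ℝ) :
    |deriv (deriv (deriv (roundedSaw δ))) x| ≤
      (1 + 2 * M ^ 2) / δ ^ 2 * (1 - s₀ * deriv (roundedSaw δ) x) + 32 / (M ^ 2 * δ ^ 2) * Real.exp (-(M ^ 2 / 2)) := by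
  have hs1 : |s₀| = 1 := by rcases hs₀ with rfl | rfl <;> norm_num
  set lam : ℝ := M / δ with hlam
  have hlam0 : 0 < lam := by positivity
  have hIw := integrable_weight_mul hs₀ (integrable_gaussKernel hδ) x
  obtain ⟨hIe0, hIe_le⟩ := integral_exp_mul_abs_gaussKernel_le hδ lam
  have hIe : Integrable fun s => Real.exp (lam * |x - s|) * gaussKernel δ (x - s) := hIe0.comp_sub_left x
  -- step A: `|S‴| ≤ ∫ w ((x−s)²/δ⁴ + 1/δ²) g`
  have hA : |deriv (deriv (deriv (roundedSaw δ))) x| ≤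
      ∫ s, (1 - s₀ * deriv tri s) * (((x - s) ^ 2 / δ ^ 4 + 1 / δ ^ 2) * gaussKernel δ (x - s)) := by
    rw [show |deriv (deriv (deriv (roundedSaw δ))) x| =
        |∫ s, (1 - s₀ * deriv tri s) * (((x - s) ^ 2 / δ ^ 4 - 1 / δ ^ 2) * gaussKernel δ (x - s))| by
      rw [integral_weight_mul_gaussKernel_deriv2 hδ s₀ x, abs_neg, abs_mul, hs1, one_mul]]
    have hI1 : Integrable fun s => (1 - s₀ * deriv tri s) * (((x - s) ^ 2 / δ ^ 4 + 1 / δ ^ 2) * gaussKernel δ (x - s)) := by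
      have hK : Integrable fun u => (u ^ 2 / δ ^ 4 + 1 / δ ^ 2) * gaussKernel δ u := by
        refine ((((integrable_pow_mul_gaussKernel hδ 2).div_const (δ ^ 4)).add
          ((integrable_gaussKernel hδ).div_const (δ ^ 2)))).congr (ae_of_all _ fun u => ?_)
        simp only [Pi.add_apply]; ring
      exact integrable_weight_mul hs₀ hK x
    refine (abs_integral_le_integral_abs).trans (integral_mono_of_nonneg (ae_of_all _ fun s => abs_nonneg _) hI1
      (ae_of_all _ fun s => ?_))
    obtain ⟨h0, -, -⟩ := weight_bounds hs₀ s
    have hg := gaussKernel_nonneg hδ.le (x - s)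
    simp only
    rw [abs_mul, abs_of_nonneg h0, abs_mul, abs_of_nonneg hg]
    refine mul_le_mul_of_nonneg_left (mul_le_mul_of_nonneg_right (abs_sub _ _ |>.trans (le_of_eq ?_)) hg) h0
    rw [abs_of_nonneg (by positivity), abs_of_nonneg (by positivity)]
  -- step B: pointwise bathtub bound with `u² ≤ 2t² + 8λ⁻²e^{λ(|u|−t)}`
  have hpt : ∀ s, (1 - s₀ * deriv tri s) * (((x - s) ^ 2 / δ ^ 4 + 1 / δ ^ 2) * gaussKernel δ (x - s)) ≤
      ((2 * (M * δ) ^ 2) / δ ^ 4 + 1 / δ ^ 2) * ((1 - s₀ * deriv tri s) * gaussKernel δ (x - s)) +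
        (16 * lam⁻¹ ^ 2 * Real.exp (-(lam * (M * δ))) / δ ^ 4) * (Real.exp (lam * |x - s|) * gaussKernel δ (x - s)) := by
    intro s
    obtain ⟨h0, h2, -⟩ := weight_bounds hs₀ s
    have hg := gaussKernel_nonneg hδ.le (x - s)
    have hb := sq_le_add_exp (x - s) (M * δ) hlam0
    have hexp : Real.exp (lam * (|x - s| - M * δ)) = Real.exp (-(lam * (M * δ))) * Real.exp (lam * |x - s|) := by
      rw [← Real.exp_add]; ring_nf
    rw [hexp] at hb
    have hwg : 0 ≤ (1 - s₀ * deriv tri s) * gaussKernel δ (x - s) := mul_nonneg h0 hg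
    have hE : 0 ≤ Real.exp (-(lam * (M * δ))) * Real.exp (lam * |x - s|) := by positivity
    calc (1 - s₀ * deriv tri s) * (((x - s) ^ 2 / δ ^ 4 + 1 / δ ^ 2) * gaussKernel δ (x - s))
        = (1 / δ ^ 4) * ((x - s) ^ 2 * ((1 - s₀ * deriv tri s) * gaussKernel δ (x - s))) +
            (1 / δ ^ 2) * ((1 - s₀ * deriv tri s) * gaussKernel δ (x - s)) := by ring
      _ ≤ (1 / δ ^ 4) * ((2 * (M * δ) ^ 2 + 8 * lam⁻¹ ^ 2 * (Real.exp (-(lam * (M * δ))) * Real.exp (lam * |x - s|))) *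
            ((1 - s₀ * deriv tri s) * gaussKernel δ (x - s))) +
            (1 / δ ^ 2) * ((1 - s₀ * deriv tri s) * gaussKernel δ (x - s)) :=
          add_le_add (mul_le_mul_of_nonneg_left (mul_le_mul_of_nonneg_right hb hwg) (by positivity)) le_rfl
      _ ≤ (1 / δ ^ 4) * ((2 * (M * δ) ^ 2) * ((1 - s₀ * deriv tri s) * gaussKernel δ (x - s)) +
            8 * lam⁻¹ ^ 2 * (Real.exp (-(lam * (M * δ))) * Real.exp (lam * |x - s|)) * (2 * gaussKernel δ (x - s))) +
            (1 / δ ^ 2) * ((1 - s₀ * deriv tri s) * gaussKernel δ (x - s)) := by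
          refine add_le_add (mul_le_mul_of_nonneg_left ?_ (by positivity)) le_rfl
          rw [add_mul]
          refine add_le_add le_rfl (mul_le_mul_of_nonneg_left ?_ (by positivity))
          exact mul_le_mul_of_nonneg_right h2 hg
      _ = _ := by ring
  have hB : ∫ s, (1 - s₀ * deriv tri s) * (((x - s) ^ 2 / δ ^ 4 + 1 / δ ^ 2) * gaussKernel δ (x - s)) ≤
      ((2 * (M * δ) ^ 2) / δ ^ 4 + 1 / δ ^ 2) * (∫ s, (1 - s₀ * deriv tri s) * gaussKernel δ (x - s)) +
        (16 * lam⁻¹ ^ 2 * Real.exp (-(lam * (M * δ))) / δ ^ 4) * (∫ s, Real.exp (lam * |x - s|) * gaussKernel δ (x - s)) := by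
    have hI1 : Integrable fun s => (1 - s₀ * deriv tri s) * (((x - s) ^ 2 / δ ^ 4 + 1 / δ ^ 2) * gaussKernel δ (x - s)) := by
      have hK : Integrable fun u => (u ^ 2 / δ ^ 4 + 1 / δ ^ 2) * gaussKernel δ u := by
        refine ((((integrable_pow_mul_gaussKernel hδ 2).div_const (δ ^ 4)).add
          ((integrable_gaussKernel hδ).div_const (δ ^ 2)))).congr (ae_of_all _ fun u => ?_)
        simp only [Pi.add_apply]; ring
      exact integrable_weight_mul hs₀ hK x
    rw [← integral_const_mul, ← integral_const_mul, ← integral_add ((hIw.const_mul _)) (hIe.const_mul _)]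
    exact integral_mono hI1 ((hIw.const_mul _).add (hIe.const_mul _)) hpt
  rw [← one_sub_mul_deriv_roundedSaw_eq hδ s₀ x, integral_sub_left_eq_self (fun u => Real.exp (lam * |u|) * gaussKernel δ u) volume x]
    at hB
  have hexp2 : Real.exp (-(lam * (M * δ))) * (2 * Real.exp (lam ^ 2 * δ ^ 2 / 2)) = 2 * Real.exp (-(M ^ 2 / 2)) := by
    rw [mul_comm, mul_assoc, ← Real.exp_add, hlam]; congr 2; field_simp; ring
  calc |deriv (deriv (deriv (roundedSaw δ))) x| ≤ _ := hA
    _ ≤ _ := hB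
    _ ≤ ((2 * (M * δ) ^ 2) / δ ^ 4 + 1 / δ ^ 2) * (1 - s₀ * deriv (roundedSaw δ) x) +
          (16 * lam⁻¹ ^ 2 * Real.exp (-(lam * (M * δ))) / δ ^ 4) * (2 * Real.exp (lam ^ 2 * δ ^ 2 / 2)) :=
        add_le_add le_rfl (mul_le_mul_of_nonneg_left hIe_le (by positivity))
    _ = (1 + 2 * M ^ 2) / δ ^ 2 * (1 - s₀ * deriv (roundedSaw δ) x) + 32 / (M ^ 2 * δ ^ 2) * Real.exp (-(M ^ 2 / 2)) := by
        rw [show 16 * lam⁻¹ ^ 2 * Real.exp (-(lam * (M * δ))) / δ ^ 4 * (2 * Real.exp (lam ^ 2 * δ ^ 2 / 2)) =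
          16 * lam⁻¹ ^ 2 / δ ^ 4 * (Real.exp (-(lam * (M * δ))) * (2 * Real.exp (lam ^ 2 * δ ^ 2 / 2))) by ring, hexp2, hlam]
        field_simp
        ring

end Summit.AnomalousDissipation.AnomalousDissipation.Theorems.SawtoothPulseCascade.K1Flat
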